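import Literature.Computability.Complexity.OracleSubroutine
import Literature.Computability.Complexity.OracleClockFst
import Literature.Computability.Complexity.TruthTableTransducers
import HarnessLib

/-!
# Calling a RANDOMISED oracle algorithm as a subroutine, polynomially many times, against an arbitrary oracle

Topic `Literature/Computability/Complexity`, sequel of `OracleSubroutine.lean` (composition with
time-local clamp bounds: `OracleAlg.exists_polyTime_compose_local`, the subroutine theorem with the
clock `M.clock q b₀` read off the whole input), of `OracleClockFst.lean` (`M.clockFst q b₀`: the clock
read off the FIRST FIELD of a paired input `⟨u, coins⟩`, `run_clockFst_boolPair`,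
`isPolyTime_clockFst`) and of `TruthTableTransducers.lean` (the non-adaptive transducer with listed
answers `ttFnAlgL Q q G`, computing `ttFnL Q q G O x = G ⟨x, code [O q₀, …, O q_{q(|x|)-1}]⟩`
against EVERY oracle).

A randomised oracle algorithm `R` of the tree (`OracleAlg.randRun R O coins fuel u`,
`Cryptography/OracleGames.lean`) is the deterministic `R` run on the pair `⟨u, c⟩` of its input and
its coins for `fuel(|u|)` rounds — the budget is a polynomial in the length of the PROPER input `u`,
not of the pair. A reduction that calls `R` as a subroutine on inputs `uⱼ` with coins `cⱼ` cut out of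
its own coin string must therefore clock the call by the first field: this file provides

* `OracleAlg.randAnswer R fuel d₀ O` — the total answer function
  `⟨u, c⟩ ↦ (R.run O (fuel |u|) ⟨u, c⟩).getD d₀` (the sample of `randRun R O · fuel u` at the coins
  `c`, defaulting a time-out to `d₀`; with `d₀ = []` this is LITERALLY the reading `o.getD []` by
  which the tree's success predicates judge a run, e.g. `Peikert2009.bddSuccess`,
  `Oracle.SolvesSearchLWE`), and `run_clockFst_randAnswer`: the clocked subroutine
  `R.clockFst fuel d₀` computes it within `fuel |w| + 1` rounds against every oracle;
* **`OracleAlg.exists_polyTime_randSubroutine`** — for polynomial-time `M`, `R`: ONE polynomial-time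
  `C` and ONE polynomial `qC` such that for EVERY oracle `O`: if `M` with the oracle
  `randAnswer R fuel d₀ O` outputs `b` within `qM |x|` rounds with queries of length `≤ qM |x|`, then
  `C` with oracle `O` outputs `b` within `qC |x|` rounds (`exists_polyTime_compose_local` with the
  inner algorithm `R.clockFst fuel d₀`; no hypothesis on `O` or on the queries of `R`);
* **`exists_polyTime_ttRandSubroutine`** — the non-adaptive case packaged for consumers: for
  `Q, G ∈ FP`, a polynomial `q` and a polynomial-time `R`, ONE polynomial-time `C : OracleAlg (List Bool)`
  and polynomial `qC` with
  `C.run O (qC |x|) x = some (ttFnL Q q G (randAnswer R fuel d₀ O) x)` for EVERY oracle `O` and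
  input `x` — "compute the `q(|x|)` subroutine inputs `Q ⟨x, 1ʲ⟩ = ⟨uⱼ, cⱼ⟩`, run `R` on each with
  its own time-out, and post-process the list of answers by `G`", deterministically in the coins
  written into `x` (the shape of the first component of Peikert's `GapSVP → LWE` reduction,
  `Cryptography/PeikertReduction.lean`, hypothesis `h₁` of
  `peikert_gapSVPZeta_to_lwe_classical_of_components`: `N` runs of the BDD solver on freshly
  perturbed instances, "accept iff some answer differs from `x - w`").

All proved; definitions with bodies; no named fact.

## References

* S. Arora, B. Barak, *Computational Complexity: A Modern Approach*, CUP 2009, §3.4 (oracle Turing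
  machines) with §1.4.1 (clocks) and Def. 7.1 (a probabilistic machine is a deterministic machine
  reading a random string) [AroraBarak2009].
* R. E. Ladner, N. A. Lynch, A. L. Selman, *A comparison of polynomial time reducibilities*,
  Theoret. Comput. Sci. 1 (1975) 103–123, §2–§3 [LadnerLynchSelman1975].
* C. Peikert, *Public-key cryptosystems from the worst-case shortest vector problem*, STOC 2009,
  proof of Thm. 3.1 (the consumer) [Peikert2009].
-/

namespace Literature.Computability.Complexity

open _root_.Computability Polynomial

namespace OracleAlg

variable {β : Type}

/-! ### The answer function of a randomised subroutine -/

/-- **The answer of the randomised subroutine `R` at given coins.** On a paired input `w = ⟨u, c⟩`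
(proper input `u = (boolUnpair w).1`, coins `c`), `randAnswer R fuel d₀ O w` is the output of `R`
with oracle `O` within `fuel(|u|)` rounds — the value sampled by `R.randRun O · fuel u` at the coins
`c` — read with the default `d₀` on a time-out. A total string function for EVERY oracle `O`.
[Arora–Barak 2009, Def. 7.1 with §3.4] [cite: AroraBarak2009, §3.4] -/
def randAnswer (R : OracleAlg (List Bool)) (fuel : Polynomial ℕ) (d₀ : List Bool) (O : Oracle) :
    Oracle :=
  fun w => (R.run O (fuel.eval (boolUnpair w).1.length) w).getD d₀

/-- `randAnswer` on a pair `⟨u, c⟩`: `(R.run O (fuel |u|) ⟨u, c⟩).getD d₀`. [folklore] -/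
@[simp] theorem randAnswer_boolPair (R : OracleAlg (List Bool)) (fuel : Polynomial ℕ) (d₀ : List Bool)
    (O : Oracle) (u c : List Bool) :
    randAnswer R fuel d₀ O (boolPair u c) = (R.run O (fuel.eval u.length) (boolPair u c)).getD d₀ := by
  simp [randAnswer]

/-- A completed run determines the answer: `R.run … ⟨u, c⟩ = some a → randAnswer ⟨u, c⟩ = a`.
[folklore] -/
theorem randAnswer_boolPair_of_run_eq_some (R : OracleAlg (List Bool)) (fuel : Polynomial ℕ) (d₀ : List Bool)
    (O : Oracle) {u c a : List Bool} (h : R.run O (fuel.eval u.length) (boolPair u c) = some a) :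
    randAnswer R fuel d₀ O (boolPair u c) = a := by
  rw [randAnswer_boolPair, h, Option.getD_some]

/-- A timed-out run gives the default answer. [folklore] -/
theorem randAnswer_boolPair_of_run_eq_none (R : OracleAlg (List Bool)) (fuel : Polynomial ℕ) (d₀ : List Bool)
    (O : Oracle) {u c : List Bool} (h : R.run O (fuel.eval u.length) (boolPair u c) = none) :
    randAnswer R fuel d₀ O (boolPair u c) = d₀ := by
  rw [randAnswer_boolPair, h, Option.getD_none]

/-- **The first-field-clocked subroutine computes `randAnswer`** within `fuel |w| + 1` rounds,
against every oracle (`|u| ≤ |w|` for the first field `u` of `w`). [Arora–Barak 2009, §3.4 with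
§1.4.1] [cite: AroraBarak2009, §3.4] -/
theorem run_clockFst_randAnswer (R : OracleAlg (List Bool)) (fuel : Polynomial ℕ) (d₀ : List Bool)
    (O : Oracle) (w : List Bool) :
    (R.clockFst fuel d₀).run O ((fuel + 1).eval w.length) w = some (randAnswer R fuel d₀ O w) := by
  have hle : (boolUnpair w).1.length ≤ w.length := by
    have := length_boolUnpair_parts_le w
    omega
  have hlt : fuel.eval (boolUnpair w).1.length < (fuel + 1).eval w.length := by
    have := TM2Iter.eval_mono fuel hle
    simp only [eval_add, eval_one]
    omega
  exact run_clockBy R (fun w => fuel.eval (boolUnpair w).1.length) d₀ O w hlt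

/-! ### The subroutine theorem for randomised subroutines -/

/-- **Polynomial-time randomised subroutines with time-outs, relative to an arbitrary oracle.** For
polynomial-time `M` (the caller, outputs coded by `eb`) and `R` (the subroutine, run on paired
inputs `⟨u, coins⟩` for `fuel(|u|)` rounds), polynomials `qM`, `fuel` and a default `d₀`, there are
ONE polynomial-time `C` and ONE polynomial `qC` such that for EVERY oracle `O`, input `x` and output
`b`: if `M`, with each query `w` answered by `randAnswer R fuel d₀ O w`, outputs `b` within `qM |x|`
rounds asking queries of length `≤ qM |x|`, then `C` with oracle `O` outputs `b` within `qC |x|`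
rounds, its queries being those of the clocked runs of `R`. (`C` is the composite of `M` with
`R.clockFst fuel d₀`.) [Arora–Barak 2009, §3.4 with §1.4.1 and Def. 7.1; Ladner–Lynch–Selman 1975,
§2] [cite: AroraBarak2009, §3.4] [cite: LadnerLynchSelman1975, §2] -/
theorem exists_polyTime_randSubroutine {eb : Encoding β Bool} {M : OracleAlg β} (hM : M.IsPolyTime eb)
    {R : OracleAlg (List Bool)} (hR : R.IsPolyTime (encodingList Bool)) (qM fuel : Polynomial ℕ)
    (d₀ : List Bool) :
    ∃ C : OracleAlg β, C.IsPolyTime eb ∧ ∃ qC : Polynomial ℕ,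
      ∀ (O : Oracle) (x : List Bool) (b : β),
        M.run (randAnswer R fuel d₀ O) (qM.eval x.length) x = some b →
        (∀ y ∈ M.queries (randAnswer R fuel d₀ O) (qM.eval x.length) x, y.length ≤ qM.eval x.length) →
        C.run O (qC.eval x.length) x = some b ∧
          C.queries O (qC.eval x.length) x =
            (M.queries (randAnswer R fuel d₀ O) (qM.eval x.length) x).flatMap fun w =>
              (R.clockFst fuel d₀).queries O ((fuel + 1).eval w.length) w := by
  obtain ⟨C, hC, qC, h⟩ :=
    exists_polyTime_compose_local hM (isPolyTime_clockFst (encodingList Bool) hR fuel d₀) qM (fuel + 1)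
  exact ⟨C, hC, qC, fun O x b hrun hq =>
    h O (randAnswer R fuel d₀ O) x b hrun hq fun w _ => run_clockFst_randAnswer R fuel d₀ O w⟩

end OracleAlg

/-! ### The non-adaptive case, packaged -/

section TT

variable {Q : List Bool → List Bool} {G : List Bool → List Bool}

/-- **A budget for `ttFnAlgL`**: with `s` an output-length bound of `Q`, the polynomial
`q + 1 + s ∘ (2X + 2 + q)` dominates the number of rounds and the lengths of the queries of
`ttFnAlgL Q q G`, against every oracle. [folklore] -/
theorem run_ttFnAlgL_budget (q s : Polynomial ℕ) (hs : ∀ w, (Q w).length ≤ s.eval w.length)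
    (O : Oracle) (x : List Bool) :
    (ttFnAlgL Q q G).run O ((q + 1 + s.comp (2 * X + 2 + q)).eval x.length) x =
        some (ttFnL Q q G O x) ∧
      ∀ y ∈ (ttFnAlgL Q q G).queries O ((q + 1 + s.comp (2 * X + 2 + q)).eval x.length) x,
        y.length ≤ (q + 1 + s.comp (2 * X + 2 + q)).eval x.length := by
  have hev : (q + 1 + s.comp (2 * X + 2 + q)).eval x.length =
      q.eval x.length + 1 + s.eval (2 * x.length + 2 + q.eval x.length) := by
    simp
  refine ⟨run_ttFnAlgL O x (by rw [hev]; omega), fun y hy => ?_⟩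
  rw [hev]
  exact (length_le_of_mem_queries_ttFnAlgL hs O x hy).trans (Nat.le_add_left _ _)

/-- **Running a randomised subroutine on polynomially many computed inputs and post-processing the
list of its answers is ONE polynomial-time oracle algorithm, for every oracle.** For `Q, G ∈ FP`, a
polynomial `q`, a polynomial-time `R` with round budget `fuel` and a default `d₀`, there are a
polynomial-time `C : OracleAlg (List Bool)` and a polynomial `qC` such that for EVERY oracle `O` and
input `x`,
`C.run O (qC |x|) x = some (ttFnL Q q G (randAnswer R fuel d₀ O) x)
 = some (G ⟨x, code [a₀, …, a_{q(|x|)-1}]⟩)`, `aⱼ = (R.run O (fuel |uⱼ|) ⟨uⱼ, cⱼ⟩).getD d₀` where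
`⟨uⱼ, cⱼ⟩ = Q ⟨x, 1ʲ⟩`. (When `x = ⟨input, coins⟩` and `Q` cuts the coins `cⱼ` of the `j`-th call out
of `coins`, this is a randomised reduction calling `R` with fresh coins `q(|x|)` times.)
[Arora–Barak 2009, §3.4 with Def. 7.1; Ladner–Lynch–Selman 1975, §3]
[cite: AroraBarak2009, §3.4] [cite: LadnerLynchSelman1975, §3] -/
theorem exists_polyTime_ttRandSubroutine (hQ : Q ∈ FP) (hG : G ∈ FP) (q : Polynomial ℕ)
    {R : OracleAlg (List Bool)} (hR : R.IsPolyTime (encodingList Bool)) (fuel : Polynomial ℕ)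
    (d₀ : List Bool) :
    ∃ C : OracleAlg (List Bool), C.IsPolyTime (encodingList Bool) ∧ ∃ qC : Polynomial ℕ,
      ∀ (O : Oracle) (x : List Bool),
        C.run O (qC.eval x.length) x = some (ttFnL Q q G (OracleAlg.randAnswer R fuel d₀ O) x) := by
  obtain ⟨s, hs⟩ := exists_poly_length_le_of_mem_FP hQ
  obtain ⟨C, hC, qC, h⟩ := OracleAlg.exists_polyTime_randSubroutine
    (isPolyTime_ttFnAlgL (q := q) hQ hG) hR (q + 1 + s.comp (2 * X + 2 + q)) fuel d₀
  refine ⟨C, hC, qC, fun O x => ?_⟩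
  have hb := run_ttFnAlgL_budget (G := G) q s hs (OracleAlg.randAnswer R fuel d₀ O) x
  exact (h O x _ hb.1 hb.2).1

end TT

end Literature.Computability.Complexity
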